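import Mathlib
import Literature.MathematicalPhysics.QuantumFieldTheory.Dimock2011to13.RegionalLogDeterminant
import Literature.MathematicalPhysics.QuantumFieldTheory.Dimock2011to13.BoundaryDeterminantTerm

/-!
# Dimock, *The renormalization group according to Balaban* II (large fields), §3.8: the ASSEMBLY of the fluctuation
# determinant — «Therefore we have det(C^{1/2}_{k,Ω′}) = det(C^{1/2}_k) exp(½b″_k|Ω^{c,(k)}| + R^{(6)}_{𝚷,Ω_{k+1}})» —
# from (stay1), (z5) and the regrouping (stay3), PROVED with the signs of the kernel and every integral convergent

**Citation header (reproduction of PUBLISHED work; template of the Bałaban lattice Yang–Mills cell).**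
J. Dimock, *The renormalization group according to Balaban II. Large fields*, J. Math. Phys. **54** (2013) 092301
(= arXiv:1212.5562v2) [Dimock2013BalabanII], §3.8 `\subsection{fluctuation integral}`: (stay1) L3221–3227, (z5) L3228–3236,
(stay2) L3237–3246, the count L3247–3258, (stay3) and `R^{(6)}`, `b′_k` L3259–3268, the assembled display and `b″_k`
L3269–3273.  TeX line numbers refer to the arXiv source held by the cell on this hub at
`run/shared/lean/archive/nearmiss/qft-balaban/dimock/src/1212.5562/1212.5562.tex` (7217 lines, sha256[:16]
75c5792fc48eacbc); every quotation below was read there this session.  Dimock's papers are published and refereed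
and are the cell's TEMPLATE, not manuscripts under audit; no quantity of the Bałaban series is touched.

**What the paper prints (verbatim; `…` marks an elision).**  L3259–3273: *"The second two terms in (stay2) can be
written −½a_k²∫₀^∞(tr[A_{k,r}Q_k(G_{k,Ω′,r} − G_{k,r})Q_kᵀA_{k,r}]_{Ω_{k+1}} − tr[A_{k,r}Q_kG_{k,r}Q_kᵀA_{k,r}]_{Ω^c_{k+1}})dr
(stay3)  The first term here is defined to be R^{(6)}_{𝚷,Ω_{k+1}} and the second term is ½a_k²b′_k|Ω^{c,(k)}_{k+1}| where
b′_k = ∫(A_{k,r}Q_kG_{k,r}Q_kᵀA_{k,r})(x,x)dr is independent of x. We will see that b_k′ is bounded in k. Therefore we have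
det(C^{1/2}_{k,Ω′}) = det(C^{1/2}_k) exp(½b″_k|Ω^{c,(k)}_k| + R^{(6)}_{𝚷,Ω_{k+1}})  where b″_k = b_k + a_k²b′_k."*

**What is reproduced here (kernel-checked, zero `sorry`).**  The siblings give (stay1) with both `tr log`'s expanded by
(z5) (`RegionalLogDeterminant.det_sqrt_regional_eq`: exponent `−½W_reg + ½W_glob + ½a_k²∫tr R_reg − ½a_k²∫tr R_glob`,
`R(r) = A_{k,r}Q_kG(r)Q_kᵀA_{k,r}`), the weight count `W = b_k·#` (`weights_eq_bk_mul`) and the finite regrouping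
(`BoundaryDeterminantTerm.regroup_stay3_neg`).  This leaf ASSEMBLES them, discharging the two analytic side conditions
the regrouping needs under the `dr`-integral:
* §1 **`trace_sub_trace_eq`**: along an embedding `e : ι ↪ ι₀` of the regional index set into the global one (image
  `Ω = Ω^{(k)}_{k+1}`), `tr X′ − tr X = Σ_{i∈ι}(X′(i,i) − X(e i,e i)) − Σ_{j∉Ω} X(j,j)` — (stay3)'s regrouping at fixed `r`;
* §2 private `integrableOn_diag`: a positive-semidefinite matrix family, continuous on a set, with integrable trace has
  every DIAGONAL ENTRY integrable (`0 ≤ R(r)(y,y) ≤ tr R(r)`); **`integral_trace_sub_trace_eq`**: then `∫(tr X′ − tr X)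
  = ∫Σ_i(X′(i,i) − X(e i, e i)) − Σ_{j∉Ω}∫X(j,j)` (the `dr`-integral commutes with the regrouping and with the finite sum
  over `Ω^c`);
* §3 the concrete family `Rfam D Q_k Q a_k aL r = A_{k,r}Q_kG_{k,r}Q_kᵀA_{k,r}` of the siblings: private
  `continuous_Akr_restrict`, `continuous_gkrInv_restrict`, `continuous_Gkr_restrict`, `continuousOn_Rfam` (continuous in
  `r ≥ 0`: rational weights, matrix inverse continuous at invertible matrices — `continuousAt_matrix_inv`), **`posSemidef_Rfam`**
  (`G_{k,r} > 0` ⟹ `R(r) ≥ 0`), hence **`integrableOn_Rfam_diag`** for the global family and, via `GkOr = Gkr(D + E)`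
  (`MultiRegionFreeFlow.GkOr_eq_Gkr`), **`integrableOn_RfamO_diag`** for the regional one;
* §4 **THE ASSEMBLY `det_sqrt_regional_eq_exp_bk_R6`**: for `D, D₀` positive definite, `𝐚_τ ≥ 0`, `QQᵀ = I`, `Q₀Q₀ᵀ = I`,
  `a_k > 0`, `aL ≥ 0`, block counts `#ι = N#σ`, `#ι₀ = N#σ₀` (print `N = L³`) and an embedding `e : ι ↪ ι₀`:
  `det C^{1/2}_{k,Ω′} = det C^{1/2}_k · exp(½b_k(#ι₀ − #ι) + ½a_k²∫₀^∞ Σ_{i}(R_reg(r)(i,i) − R_glob(r)(e i,e i))dr −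
  ½a_k² Σ_{j∉Ω}∫₀^∞ R_glob(r)(j,j)dr)`, `b_k = (1 − N⁻¹)log a_k + N⁻¹log(a_k + aL)`; and **`…_of_bprime`**: if
  `∫₀^∞R_glob(r)(j,j)dr = b′_k` for every `j ∉ Ω` (*"is independent of x"*) the exponent is `½(b_k − a_k²b′_k)·#Ω^c −
  R^{(6)}`, `R^{(6)} := −½a_k²∫₀^∞Σ_i(R_reg(r)(i,i) − R_glob(r)(e i, e i))dr` as printed (L3266, L3568–3570);
* §5 a one-site non-vacuity `example`.

**Readings (declared).**  (i) The regional and global operators live on separate index types related only by the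
embedding `e` (print: `Ω^{(k)}_{k+1} ⊂ 𝕋⁰_{𝖬+𝖭−k}`); the print's `[·]_{Ω_{k+1}}` restriction of `D_{k,r} = Q_kG_{k,r}Q_kᵀ`
is read as evaluating the global diagonal at `e i`.  (ii) SIGNS: the assembled exponent is `½(b_k − a_k²b′_k)|Ω^c| −
R^{(6)}_print`, whereas the print (L3270–3273, following (stay2)'s integral signs — see the sign records in the siblings'
headers and TEMPLATE.md row «D2 §3.8») has `½(b_k + a_k²b′_k)|Ω^c| + R^{(6)}`; downstream only `|R^{(6)}(□)|` (Lemma `r6`,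
`BoundaryDeterminantTerm.abs_R6loc_le`) and the boundedness of `b′_k` (`abs_bprime_le`) are used, so nothing of
substance depends on the convention; recorded, not adjudicated.  (iii) `|Ω^{c,(k)}_k|` at L3271 vs `|Ω^{c,(k)}_{k+1}|` at
L3265∕L3289: read as `#ι₀ − #ι` (the complement of the image of `e`).

**What is NOT claimed.**  The bounds (Lemma `r6`, `b′_k` bounded — sibling `BoundaryDeterminantTerm`, with their
random-walk inputs NOT reproduced), translation invariance of `(A_{k,r}Q_kG_{k,r}Q_kᵀA_{k,r})(x,x)` (hypothesis of the
corollary), (sugar), `c_{k+1}`, the Gaussian normalisation; anything of B1–B16 (TEMPLATE.md §4.2 row «D2 §3.8» B-side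
loci untouched).  NOT summit progress; NOT a statement about any Bałaban paper; NOT continuum; NOT Clay.  NEW leaf;
imports Mathlib + the two siblings named; no Summits import; sub-namespace `…Dimock2011to13.FluctuationDeterminantAssembly`;
modifies nothing.  Unit `b2b-balaban-template` gen 35 (journal CLAIM D2-STAY3-ASSEMBLY); cell records TEMPLATE.md §4.2 row
«D2 §3.8», GAPS C-tmpl35-9.
-/

noncomputable section

open scoped BigOperators Matrix MatrixOrder
open Finset MeasureTheory Set Filter Topology Matrix

namespace Literature.MathematicalPhysics.QuantumFieldTheory.Dimock2011to13.FluctuationDeterminantAssembly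

open FluctuationCovarianceIdentity MultiRegionFreeFlow RegionalLogDeterminant BoundaryDeterminantTerm

/-! ## §1 The regrouping of (stay3) at fixed `r`: two traces along an embedding -/

section Regroup

variable {ι ι₀ : Type*} [Fintype ι] [Fintype ι₀] [DecidableEq ι₀]

/-- **(stay3) at fixed `r`**: along an embedding `e : ι ↪ ι₀` (the regional index set `Ω^{(k)}_{k+1}` inside the global
`𝕋⁰`), `tr X′ − tr X = Σ_{i}(X′(i,i) − X(e i, e i)) − Σ_{j ∉ Ω} X(j,j)` — *"The second two terms in (stay2) can be
written −½a_k²∫₀^∞(tr[A Q_k(G_{k,Ω′,r} − G_{k,r})Q_kᵀA]_{Ω_{k+1}} − tr[A Q_kG_{k,r}Q_kᵀA]_{Ω^c_{k+1}})dr"*.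
[cite: Dimock2013BalabanII, §3.8 eq. (stay3) (arXiv:1212.5562v2 TeX L3259–3266)] -/
theorem trace_sub_trace_eq (e : ι ↪ ι₀) (X' : Matrix ι ι ℝ) (X : Matrix ι₀ ι₀ ℝ) :
    trace X' - trace X = (∑ i, (X' i i - X (e i) (e i))) - ∑ j ∈ (univ.map e)ᶜ, X j j := by
  have hsplit : trace X = ∑ j ∈ univ.map e, X j j + ∑ j ∈ (univ.map e)ᶜ, X j j := by
    rw [Matrix.trace, Finset.sum_add_sum_compl]
    rfl
  rw [hsplit, Finset.sum_map, Matrix.trace, Finset.sum_sub_distrib]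
  simp only [Matrix.diag_apply]
  ring

end Regroup

/-! ## §2 Diagonal entries of a positive-semidefinite family with integrable trace are integrable; the `dr`-integral
commutes with the regrouping -/

section Diag

variable {n : Type*} [Fintype n] [DecidableEq n]

omit [DecidableEq n] in
/-- `0 ≤ M(y,y) ≤ tr M` for `M ≥ 0`. [folklore] -/
private theorem diag_le_trace {M : Matrix n n ℝ} (hM : M.PosSemidef) (y : n) : M y y ≤ trace M := by
  rw [Matrix.trace]
  exact Finset.single_le_sum (f := fun j => M.diag j) (fun j _ => hM.diag_nonneg) (Finset.mem_univ y)

omit [DecidableEq n] in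
/-- **Integrable trace ⟹ integrable diagonal** for a positive-semidefinite matrix family continuous on a measurable
set `S` (domination `0 ≤ R(r)(y,y) ≤ tr R(r)`). [folklore] -/
private theorem integrableOn_diag {S : Set ℝ} (hS : MeasurableSet S) {R : ℝ → Matrix n n ℝ}
    (hpsd : ∀ r ∈ S, (R r).PosSemidef) (hcont : ContinuousOn R S)
    (htr : IntegrableOn (fun r => trace (R r)) S) (y : n) :
    IntegrableOn (fun r => R r y y) S := by
  have hmeas : AEStronglyMeasurable (fun r => R r y y) (volume.restrict S) := by
    have hc : ContinuousOn (fun r => R r y y) S := by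
      rw [continuousOn_iff_continuous_restrict] at hcont ⊢
      exact hcont.matrix_elem y y
    exact hc.aestronglyMeasurable hS
  refine Integrable.mono' htr hmeas ?_
  refine (ae_restrict_iff' hS).2 (ae_of_all _ fun r hr => ?_)
  rw [Real.norm_eq_abs, abs_of_nonneg (hpsd r hr).diag_nonneg]
  exact diag_le_trace (hpsd r hr) y

variable {ι ι₀ : Type*} [Fintype ι] [Fintype ι₀] [DecidableEq ι] [DecidableEq ι₀]

omit [DecidableEq ι] in
/-- **The `dr`-integral commutes with the regrouping (stay3)**: if every diagonal entry of the regional family `X′`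
and of the global family `X` is integrable on `S`, then `∫_S(tr X′ − tr X) = ∫_S Σ_i(X′(i,i) − X(e i,e i)) − Σ_{j∉Ω}∫_S
X(j,j)`. [cite: Dimock2013BalabanII, §3.8 eqs. (stay2)–(stay3) (arXiv:1212.5562v2 TeX L3237–3268)] -/
theorem integral_trace_sub_trace_eq {S : Set ℝ} (e : ι ↪ ι₀) {X' : ℝ → Matrix ι ι ℝ} {X : ℝ → Matrix ι₀ ι₀ ℝ}
    (hX' : ∀ i, IntegrableOn (fun r => X' r i i) S) (hX : ∀ j, IntegrableOn (fun r => X r j j) S) :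
    ∫ r in S, (trace (X' r) - trace (X r))
      = (∫ r in S, ∑ i, (X' r i i - X r (e i) (e i))) - ∑ j ∈ (univ.map e)ᶜ, ∫ r in S, X r j j := by
  simp_rw [trace_sub_trace_eq e]
  have h1 : IntegrableOn (fun r => ∑ i, (X' r i i - X r (e i) (e i))) S :=
    integrable_finsetSum _ fun i _ => (hX' i).sub (hX (e i))
  have h2 : IntegrableOn (fun r => ∑ j ∈ (univ.map e)ᶜ, X r j j) S :=
    integrable_finsetSum _ fun j _ => hX j
  rw [integral_sub h1 h2, integral_finsetSum _ fun j _ => hX j]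

end Diag

/-! ## §3 The concrete family `R(r) = A_{k,r}Q_kG_{k,r}Q_kᵀA_{k,r}`: continuity in `r ≥ 0`, positivity, integrable
diagonal -/

section Family

variable {ι κ σ : Type*} [Fintype ι] [Fintype κ] [Fintype σ] [DecidableEq ι] [DecidableEq κ] [DecidableEq σ]
variable {D : Matrix κ κ ℝ} {Qk : Matrix ι κ ℝ} {Q : Matrix σ ι ℝ} {ak aL : ℝ}

/-- `R(r) = A_{k,r}Q_kG_{k,r}Q_kᵀA_{k,r}` (the integrand of (z5), global or — at `D + E` — regional).
[cite: Dimock2013BalabanII, §3.8 eq. (z5) (arXiv:1212.5562v2 TeX L3228–3236)] -/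
def Rfam (D : Matrix κ κ ℝ) (Qk : Matrix ι κ ℝ) (Q : Matrix σ ι ℝ) (ak aL r : ℝ) : Matrix ι ι ℝ :=
  Akr Q ak aL r * Qk * Gkr D Qk Q ak aL r * Qkᵀ * Akr Q ak aL r

/-- `x ↦ (c + x)⁻¹` is continuous on the half-line `x ≥ 0` for `c > 0`. [folklore] -/
private theorem continuous_inv_const_add {c : ℝ} (hc : 0 < c) :
    Continuous fun x : Ici (0 : ℝ) => (c + (x : ℝ))⁻¹ :=
  Continuous.inv₀ (continuous_const.add continuous_subtype_val) fun x => by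
    have hx : (0 : ℝ) ≤ x := x.2
    exact ne_of_gt (by linarith)

omit [Fintype ι] [Fintype κ] [DecidableEq κ] [DecidableEq σ] in
/-- `r ↦ A_{k,r}` is continuous on `r ≥ 0` (`a_k > 0`, `aL ≥ 0`). [folklore] -/
private theorem continuous_Akr_restrict (hak : 0 < ak) (haL : 0 ≤ aL) :
    Continuous fun x : Ici (0 : ℝ) => Akr Q ak aL (x : ℝ) := by
  unfold Akr
  have h1 : Continuous fun x : Ici (0 : ℝ) => (ak + (x : ℝ))⁻¹ := continuous_inv_const_add hak
  have h2 : Continuous fun x : Ici (0 : ℝ) => (ak + aL + (x : ℝ))⁻¹ := continuous_inv_const_add (by linarith)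
  exact (h1.smul continuous_const).add (h2.smul continuous_const)

omit [Fintype κ] [DecidableEq κ] [DecidableEq σ] in
/-- `r ↦ (bracket of G_{k,r}) = D + a_kQ_kᵀQ_k − a_k²Q_kᵀA_{k,r}Q_k` is continuous on `r ≥ 0`. [folklore] -/
private theorem continuous_gkrInv_restrict (hak : 0 < ak) (haL : 0 ≤ aL) :
    Continuous fun x : Ici (0 : ℝ) => gkrInv D Qk Q ak aL (x : ℝ) := by
  unfold gkrInv
  have hA := continuous_Akr_restrict (Q := Q) hak haL
  have h1 : Continuous fun x : Ici (0 : ℝ) => Qkᵀ * Akr Q ak aL (x : ℝ) * Qk :=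
    (continuous_const.matrix_mul hA).matrix_mul continuous_const
  have h2 : Continuous fun x : Ici (0 : ℝ) => ak ^ 2 • (Qkᵀ * Akr Q ak aL (x : ℝ) * Qk) := by
    show Continuous ((fun _ : Ici (0 : ℝ) => ak ^ 2) • fun x : Ici (0 : ℝ) => Qkᵀ * Akr Q ak aL (x : ℝ) * Qk)
    exact continuous_const.smul h1
  show Continuous ((fun _ : Ici (0 : ℝ) => D + ak • (Qkᵀ * Qk)) -
    fun x : Ici (0 : ℝ) => ak ^ 2 • (Qkᵀ * Akr Q ak aL (x : ℝ) * Qk))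
  exact continuous_const.sub h2

/-- `r ↦ G_{k,r}` is continuous on `r ≥ 0` (its bracket is invertible there, `gkrInv_posDef`, and matrix inversion is
continuous at invertible matrices). [folklore] -/
private theorem continuous_Gkr_restrict (hD : D.PosDef) (hQ : Q * Qᵀ = 1) (hak : 0 < ak) (haL : 0 ≤ aL) :
    Continuous fun x : Ici (0 : ℝ) => Gkr D Qk Q ak aL (x : ℝ) := by
  unfold Gkr
  refine continuous_iff_continuousAt.2 fun x => ?_
  have hdet : (gkrInv D Qk Q ak aL (x : ℝ)).det ≠ 0 := (gkrInv_posDef hD hQ hak haL x.2).det_pos.ne'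
  have hinv : ContinuousAt Inv.inv (gkrInv D Qk Q ak aL (x : ℝ)) :=
    continuousAt_matrix_inv _ (by simpa using NormedRing.inverse_continuousAt (Units.mk0 _ hdet))
  have hg : ContinuousAt (fun x : Ici (0 : ℝ) => gkrInv D Qk Q ak aL (x : ℝ)) x :=
    (continuous_gkrInv_restrict hak haL).continuousAt
  show ContinuousAt (Inv.inv ∘ fun x : Ici (0 : ℝ) => gkrInv D Qk Q ak aL (x : ℝ)) x
  exact ContinuousAt.comp hinv hg

/-- `r ↦ R(r)` is continuous on `r ≥ 0`. [folklore] -/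
private theorem continuousOn_Rfam (hD : D.PosDef) (hQ : Q * Qᵀ = 1) (hak : 0 < ak) (haL : 0 ≤ aL) :
    ContinuousOn (fun r : ℝ => Rfam D Qk Q ak aL r) (Ici 0) := by
  rw [continuousOn_iff_continuous_restrict]
  have hA := continuous_Akr_restrict (Q := Q) hak haL
  have hG := continuous_Gkr_restrict (Qk := Qk) hD hQ hak haL
  exact (((hA.matrix_mul continuous_const).matrix_mul hG).matrix_mul continuous_const).matrix_mul hA

/-- `R(r) ≥ 0` for `r ≥ 0`: `G_{k,r} > 0`, so `Q_kG_{k,r}Q_kᵀ ≥ 0` and `A_{k,r}(…)A_{k,r} ≥ 0` (`A_{k,r}` symmetric).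
[cite: Dimock2013BalabanII, §3.8 (arXiv:1212.5562v2 TeX L3266–3268)] -/
theorem posSemidef_Rfam (hD : D.PosDef) (hQ : Q * Qᵀ = 1) (hak : 0 < ak) (haL : 0 ≤ aL) {r : ℝ} (hr : 0 ≤ r) :
    (Rfam D Qk Q ak aL r).PosSemidef := by
  unfold Rfam Gkr
  have hG : (gkrInv D Qk Q ak aL r)⁻¹.PosSemidef := (gkrInv_posDef hD hQ hak haL hr).inv.posSemidef
  have h1 : (Qk * (gkrInv D Qk Q ak aL r)⁻¹ * Qkᴴ).PosSemidef := hG.mul_mul_conjTranspose_same Qk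
  have h2 := h1.mul_mul_conjTranspose_same (Akr Q ak aL r)
  rw [conjTranspose_eq_transpose_of_trivial, conjTranspose_eq_transpose_of_trivial, Akr_transpose] at h2
  simpa only [Matrix.mul_assoc] using h2

/-- **Every diagonal entry `r ↦ (A_{k,r}Q_kG_{k,r}Q_kᵀA_{k,r})(y,y)` is integrable on `(0,∞)`** (so `b′_k =
∫(A_{k,r}Q_kG_{k,r}Q_kᵀA_{k,r})(x,x)dr` is a convergent integral). [cite: Dimock2013BalabanII, §3.8 (arXiv:1212.5562v2 TeX L3266–3268)] -/
theorem integrableOn_Rfam_diag (hD : D.PosDef) (hQ : Q * Qᵀ = 1) (hak : 0 < ak) (haL : 0 ≤ aL) (y : ι) :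
    IntegrableOn (fun r => Rfam D Qk Q ak aL r y y) (Ioi 0) :=
  integrableOn_diag measurableSet_Ioi (fun _ hr => posSemidef_Rfam hD hQ hak haL (le_of_lt hr))
    ((continuousOn_Rfam hD hQ hak haL).mono Ioi_subset_Ici_self) (integrableOn_trace_AQGQA hD hQ hak haL) y

variable {τ : Type*} [Fintype τ] {Qτ : Matrix τ κ ℝ} {aτ : Matrix τ τ ℝ}

omit [DecidableEq κ] in
/-- `E = Q_τᵀ𝐚_τQ_τ ≥ 0` for `𝐚_τ ≥ 0`. [folklore] -/
private theorem restE_posSemidef' (haτ : aτ.PosSemidef) (Qτ : Matrix τ κ ℝ) : (restE aτ Qτ).PosSemidef := by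
  have h := haτ.conjTranspose_mul_mul_same Qτ
  rwa [conjTranspose_eq_transpose_of_trivial] at h

omit [DecidableEq σ] in
/-- the regional integrand `A_{k,r}Q_kG_{k,Ω⁺,r}Q_kᵀA_{k,r}` is `Rfam (D + E)` for `r > 0`. [cite: Dimock2013BalabanII, App. C (z4) (arXiv:1212.5562v2 TeX L6586–6601)] -/
theorem RfamO_eq (hak : 0 < ak) (haL : 0 ≤ aL) {r : ℝ} (hr : 0 < r) :
    Akr Q ak aL r * Qk * GkOr D ak aτ Qk Qτ Q aL r * Qkᵀ * Akr Q ak aL r = Rfam (D + restE aτ Qτ) Qk Q ak aL r := by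
  unfold Rfam
  rw [GkOr_eq_Gkr (by linarith) (by linarith)]

/-- every diagonal entry of the REGIONAL integrand is integrable on `(0,∞)`. [cite: Dimock2013BalabanII, §3.8 eq. (z5) (arXiv:1212.5562v2 TeX L3228–3236)] -/
theorem integrableOn_RfamO_diag (hD : D.PosDef) (haτ : aτ.PosSemidef) (hQ : Q * Qᵀ = 1) (hak : 0 < ak)
    (haL : 0 ≤ aL) (y : ι) :
    IntegrableOn (fun r => (Akr Q ak aL r * Qk * GkOr D ak aτ Qk Qτ Q aL r * Qkᵀ * Akr Q ak aL r) y y) (Ioi 0) := by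
  have h := integrableOn_Rfam_diag (Qk := Qk) (hD.add_posSemidef (restE_posSemidef' haτ Qτ)) hQ hak haL y
  refine h.congr_fun (fun r hr => ?_) measurableSet_Ioi
  have hr' : 0 < r := hr
  rw [RfamO_eq hak haL hr']

end Family

/-! ## §4 The assembly: `det C^{1/2}_{k,Ω′} = det C^{1/2}_k · exp(½b_k|Ω^c| + ½a_k²∫Σ_Ω(R_reg − R_glob) − ½a_k²Σ_{Ω^c}∫R_glob)` -/

section Assembly

variable {ι κ σ τ : Type*} [Fintype ι] [Fintype κ] [Fintype σ] [Fintype τ] [DecidableEq ι] [DecidableEq κ]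
  [DecidableEq σ]
variable {ι₀ κ₀ σ₀ : Type*} [Fintype ι₀] [Fintype κ₀] [Fintype σ₀] [DecidableEq ι₀] [DecidableEq κ₀] [DecidableEq σ₀]
variable {D : Matrix κ κ ℝ} {Qk : Matrix ι κ ℝ} {Qτ : Matrix τ κ ℝ} {aτ : Matrix τ τ ℝ} {Q : Matrix σ ι ℝ}
variable {D₀ : Matrix κ₀ κ₀ ℝ} {Qk₀ : Matrix ι₀ κ₀ ℝ} {Q₀ : Matrix σ₀ ι₀ ℝ} {ak aL : ℝ}

/-- `b_k = (1 − N⁻¹)log a_k + N⁻¹log(a_k + aL)` (print `N = L³`: *"½((1 − L^{−3}) log a_k + L^{−3} log(a_k + aL^{−2}))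
|Ω^{c,(k)}_{k+1}| ≡ ½b_k|Ω^{c,(k)}_{k+1}|"*). [cite: Dimock2013BalabanII, §3.8 (arXiv:1212.5562v2 TeX L3255–3258)] -/
def bk (N : ℕ) (ak aL : ℝ) : ℝ := (1 - (N : ℝ)⁻¹) * Real.log ak + (N : ℝ)⁻¹ * Real.log (ak + aL)

/-- **THE ASSEMBLY OF §3.8** — *"Therefore we have det(C^{1/2}_{k,Ω′}) = det(C^{1/2}_k) exp(½b″_k|Ω^{c,(k)}| +
R^{(6)}_{𝚷,Ω_{k+1}})"*, here with the kernel's signs and all integrals convergent: for `D, D₀ > 0`, `𝐚_τ ≥ 0`, `QQᵀ = I`,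
`Q₀Q₀ᵀ = I`, `a_k > 0`, `aL ≥ 0`, block counts `#ι = N·#σ`, `#ι₀ = N·#σ₀` and an embedding `e : ι ↪ ι₀` (`Ω^{(k)}_{k+1} ⊂
𝕋⁰`): `det C^{1/2}_{k,Ω′} = det C^{1/2}_k · exp(½b_k(#ι₀ − #ι) + ½a_k²∫₀^∞Σ_i(R_reg(r)(i,i) − R_glob(r)(e i,e i))dr − ½a_k²
Σ_{j∉Ω}∫₀^∞R_glob(r)(j,j)dr)` — the three pieces being `½b_k|Ω^{c,(k)}|`, `−R^{(6)}` (with `R^{(6)}` as defined at L3266,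
L3568–3570) and `−½a_k²Σ_{x∈Ω^c}∫(A_{k,r}Q_kG_{k,r}Q_kᵀA_{k,r})(x,x)dr`. [cite: Dimock2013BalabanII, §3.8 eqs. (stay1)–(stay3) and the display after them (arXiv:1212.5562v2 TeX L3221–3273)] -/
theorem det_sqrt_regional_eq_exp_bk_R6 (hD : D.PosDef) (haτ : aτ.PosSemidef) (hQ : Q * Qᵀ = 1) (hD₀ : D₀.PosDef)
    (hQ₀ : Q₀ * Q₀ᵀ = 1) (hak : 0 < ak) (haL : 0 ≤ aL) {N : ℕ} (hN0 : N ≠ 0)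
    (hN : Fintype.card ι = N * Fintype.card σ) (hN₀ : Fintype.card ι₀ = N * Fintype.card σ₀) (e : ι ↪ ι₀) :
    (CFC.sqrt ((DeltakO D (weightO ak aτ) (rowsO Qk Qτ)).toBlocks₁₁ + aL • proj Q)⁻¹).det
      = (CFC.sqrt (Deltak D₀ Qk₀ ak + aL • proj Q₀)⁻¹).det *
        Real.exp ((1 / 2) * bk N ak aL * (Fintype.card ι₀ - Fintype.card ι)
          + (1 / 2) * ak ^ 2 * (∫ r in Ioi (0 : ℝ), ∑ i,
              ((Akr Q ak aL r * Qk * GkOr D ak aτ Qk Qτ Q aL r * Qkᵀ * Akr Q ak aL r) i i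
                - Rfam D₀ Qk₀ Q₀ ak aL r (e i) (e i)))
          - (1 / 2) * ak ^ 2 * ∑ j ∈ (univ.map e)ᶜ, ∫ r in Ioi (0 : ℝ), Rfam D₀ Qk₀ Q₀ ak aL r j j) := by
  rw [det_sqrt_regional_eq hD haτ hQ hD₀ hQ₀ hak haL, weights_eq_bk_mul hN hN0, weights_eq_bk_mul hN₀ hN0]
  congr 1
  congr 1
  have hsplit := integral_trace_sub_trace_eq (S := Ioi (0 : ℝ)) e
    (X' := fun r => Akr Q ak aL r * Qk * GkOr D ak aτ Qk Qτ Q aL r * Qkᵀ * Akr Q ak aL r)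
    (X := fun r => Rfam D₀ Qk₀ Q₀ ak aL r)
    (integrableOn_RfamO_diag hD haτ hQ hak haL) (integrableOn_Rfam_diag hD₀ hQ₀ hak haL)
  have hint : (∫ r in Ioi (0 : ℝ), trace (Akr Q ak aL r * Qk * GkOr D ak aτ Qk Qτ Q aL r * Qkᵀ * Akr Q ak aL r))
      - ∫ r in Ioi (0 : ℝ), trace (Akr Q₀ ak aL r * Qk₀ * Gkr D₀ Qk₀ Q₀ ak aL r * Qk₀ᵀ * Akr Q₀ ak aL r)
      = ∫ r in Ioi (0 : ℝ), (trace (Akr Q ak aL r * Qk * GkOr D ak aτ Qk Qτ Q aL r * Qkᵀ * Akr Q ak aL r)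
          - trace (Rfam D₀ Qk₀ Q₀ ak aL r)) := by
    rw [← integral_sub (integrableOn_trace_AQGOrQA hD haτ hQ hak haL) (integrableOn_trace_AQGQA hD₀ hQ₀ hak haL)]
    rfl
  unfold bk
  linear_combination ((1 / 2) * ak ^ 2) * (hint.trans hsplit)

/-- **… and with `b′_k`**: if `∫₀^∞(A_{k,r}Q_kG_{k,r}Q_kᵀA_{k,r})(x,x)dr = b′_k` for every `x ∉ Ω` (*"is independent of x"*),
the exponent is `½(b_k − a_k²b′_k)·#Ω^c − R^{(6)}` with `R^{(6)} = −½a_k²∫₀^∞Σ_{y∈Ω}(A_{k,r}(D_{k,Ω′,r} − D_{k,r})A_{k,r})(y,y)dr`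
as printed — *"det(C^{1/2}_{k,Ω′}) = det(C^{1/2}_k) exp(½b″_k|Ω^{c,(k)}| + R^{(6)}) where b″_k = b_k + a_k²b′_k"* up to the
sign convention recorded in the header's reading (ii). [cite: Dimock2013BalabanII, §3.8 (arXiv:1212.5562v2 TeX L3266–3273)] -/
theorem det_sqrt_regional_eq_exp_bk_R6_of_bprime (hD : D.PosDef) (haτ : aτ.PosSemidef) (hQ : Q * Qᵀ = 1)
    (hD₀ : D₀.PosDef) (hQ₀ : Q₀ * Q₀ᵀ = 1) (hak : 0 < ak) (haL : 0 ≤ aL) {N : ℕ} (hN0 : N ≠ 0)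
    (hN : Fintype.card ι = N * Fintype.card σ) (hN₀ : Fintype.card ι₀ = N * Fintype.card σ₀) (e : ι ↪ ι₀)
    {b' : ℝ} (hb' : ∀ j ∈ (univ.map e)ᶜ, ∫ r in Ioi (0 : ℝ), Rfam D₀ Qk₀ Q₀ ak aL r j j = b') :
    (CFC.sqrt ((DeltakO D (weightO ak aτ) (rowsO Qk Qτ)).toBlocks₁₁ + aL • proj Q)⁻¹).det
      = (CFC.sqrt (Deltak D₀ Qk₀ ak + aL • proj Q₀)⁻¹).det *
        Real.exp ((1 / 2) * (bk N ak aL - ak ^ 2 * b') * (Fintype.card ι₀ - Fintype.card ι)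
          - (-(1 / 2) * ak ^ 2 * (∫ r in Ioi (0 : ℝ), ∑ i,
              ((Akr Q ak aL r * Qk * GkOr D ak aτ Qk Qτ Q aL r * Qkᵀ * Akr Q ak aL r) i i
                - Rfam D₀ Qk₀ Q₀ ak aL r (e i) (e i))))) := by
  rw [det_sqrt_regional_eq_exp_bk_R6 hD haτ hQ hD₀ hQ₀ hak haL hN0 hN hN₀ e]
  congr 2
  have hsum : ∑ j ∈ (univ.map e)ᶜ, ∫ r in Ioi (0 : ℝ), Rfam D₀ Qk₀ Q₀ ak aL r j j
      = b' * (Fintype.card ι₀ - Fintype.card ι) := by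
    rw [Finset.sum_congr rfl hb', Finset.sum_const, nsmul_eq_mul, Finset.card_compl, Finset.card_map,
      Finset.card_univ, Nat.cast_sub (Fintype.card_le_of_embedding e)]
    ring
  rw [hsum]
  ring

end Assembly

/-! ## §5 Non-vacuity -/

/-- The diagonal-integrability hypotheses are met on one site (`D = Q_k = Q = 1`, `a_k = 1`, `aL = 0`). -/
example : IntegrableOn (fun r => Rfam (1 : Matrix Unit Unit ℝ) (1 : Matrix Unit Unit ℝ) (1 : Matrix Unit Unit ℝ) 1 0 r
    () ()) (Ioi 0) :=
  integrableOn_Rfam_diag Matrix.PosDef.one (by simp) one_pos le_rfl ()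

end Literature.MathematicalPhysics.QuantumFieldTheory.Dimock2011to13.FluctuationDeterminantAssembly

end
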